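import Literature.NumberTheory.Automorphic.SLTwoTreeVertexLevel                       -- ★-to-be (A-p17 (g23), (V-top) core part 1): `exists_level`, `level_unique`, `primitive_glInt_mul_mul_glInt`, `level_eq_of_glVertexAct_eq`
import Literature.NumberTheory.Automorphic.SLTwoTreeQuadraticTorusShellIndexCount     -- ★ A-p01 (g21) p844066: `valuation_eq_one_of_eisenstein_norm`; ⊇ ★ (W′1) I `coe_inv_mul_torus_mul_of_coe_eq_diagonal`, `isIntegralMatrix_shellConj_iff`
import HarnessLib

/-!
# The LEVEL of the shell conjugates of a torus unit: `r_m⁻¹ γ r_m` sits at distance `2 (m − ord b)₊` from the root — the tree core of the (V-top) law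
# «`fbar m t = 0` for `m > ord b(t) + R`» (Labesse–Langlands 1979, §2 (2.1) p. 8)

Topic `NumberTheory/Automorphic`; namespace `Literature.NumberTheory.Automorphic.HermitianLatticeTree` (ROAD W's).  KERNEL mathematics only: theorems, no definition, no
named fact, no instance, no notation, no `sorry`.  Cell `pub/hodgecm-mathlib` (D-0151), crux H413 = `stmt-HodgeConjecture-24833`, line «N6nsGerm», road «W′» = «R1LL-WILD»
(architect A-p16 (g28) RULING A-44; (W′-B6) F0P3-p01 (g14) fold ★ p844200 `exists_wildLaw_torus_of_shellLaws`, binder `htop`; (B6-V) owner B-p14 (g33) shed the sub-socket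
**(V-top)** «`oT t + R < m ⇒ fbar m ↑t = 0 ∧ fbar m (e ↑t) = 0`» to this seat 12:34:21Z).  Seat A-p17 (g23) ((W′1) I–VII ★ p843889…p844146; (V-top) core part 1 = `SLTwoTreeVertexLevel`).
HONEST LABEL: HC_CM is proved only modulo the cell's 2 remaining named inputs (hLiu418, h413) until rung 0 closes; nothing printed is asserted here — valuation bookkeeping.

THE MATHEMATICS (Eisenstein shape `u ∈ 𝒪`, `|u| < 1`, `|v| = |ϖ|`; `γ = (a, bv; b, a+bu)` a UNIT of the order — `a b ∈ 𝒪`, `|det γ| = 1`, so `|a| = 1` by ★ A-p01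
`valuation_eq_one_of_eisenstein_norm` — with `|b| = |ϖ|^{oT}`; `r_m = diag(1, π^m)` for ANY `π` with `|π| = |ϖ|` (the consumers' `π` is a norm `η_E σ_w η_E`, not the tree's `ϖ`); «level» = the primitive-representative data of `SLTwoTreeVertexLevel`, i.e. the tree distance
from the root `v₀` to the vertex).  The shell average `fbar m t` of the (Ψ1) unfolding (★ B-p14 p844070) reads the test function at `K`-conjugates of the SHELL CONJUGATE
`S_m := r_m⁻¹ γ r_m = (a, b v ϖ^m; b ϖ^{−m}, a + bu)` (★ (W′1) I, LL (2.1)); a compactly supported `f` sees only elements of level `≤ R` (its support radius: the level is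
`GL₂(𝒪)`-bi-invariant, so it is read on the finite vertex set `(K · supp f) · v₀`); hence `fbar m t = 0` as soon as `level(S_m) > R`.
* §4 **`level_data_shellConj_of_le`** (`m ≤ oT`): `S_m` is integral with a unit entry and unit determinant — level `0` (it FIXES `v₀`: ★ I `glVertexAct_torus_shell_eq_iff`).
* §4 **`level_data_shellConj_of_ge`** (`oT ≤ m`, `m = oT + k`): `S_m = (b ϖ^{−m}) • g₀` with `g₀ = (a ϖ^m∕b, v ϖ^{2m}; 1, (a+bu) ϖ^m∕b)` primitive integral, `|det g₀| = |ϖ|^{2k}` —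
  **level `2 (m − oT)`** (the vertex `S_m · v₀ = r_m⁻¹ · (γ · x_m)` is `2(m − oT)` steps from the root: down from `x_m` to the shell `oT`, where `γ` starts to act trivially, and back up).
* §5 **`level_gt_of_shellConj` ((V-top) CORE)**: for ANY primitive data `(c, g₀, n)` of `S_m` (or of `k S_m k′`, `k k′ ∈ GL₂(𝒪)` — the partner `D_u⁻¹ γ D_u`'s shell conjugate is
  `D_u⁻¹ S_m D_u`), **`oT + R < m ⇒ R < n`** (indeed `n = 2(m − oT) > 2R`).  CONSUMER ((B6-V)∕(B6-H)): with «support radius `R`» := a bound on the level of the vertices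
  `Y · x₀`, `f Y ≠ 0` (finite set ★ (B6-H)), `f(k⁻¹ S_m k) ≠ 0` would force `level(S_m) ≤ R` (★ `level_eq_of_glVertexAct_eq`: `(k⁻¹ S_m k) · v₀ = k⁻¹ · (S_m · v₀)`, `k ∈ K`
  fixes `v₀` and the level is a function of the vertex) — contradiction; so `fbar m t = 0`.

## References
* [LabesseLanglands1979] J.-P. Labesse, R. P. Langlands, *L-indistinguishability for SL(2)*, Canad. J. Math. 31 (1979), §2 (2.1) p. 8.
* [Serre1980Trees] J.-P. Serre, *Trees* (1980), Ch. II §1.1 (distance via elementary divisors).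
-/

set_option autoImplicit false

noncomputable section

open scoped ValuativeRel Matrix MatrixGroups
open Matrix ValuativeRel

namespace Literature.NumberTheory.Automorphic.HermitianLatticeTree

open Literature.NumberTheory.Automorphic Literature.NumberTheory.LocalFields

variable {F : Type*} [Field F] [ValuativeRel F] {ϖ : F} (hϖ : IsUniformizingElement ϖ) [IsDiscreteValuationRing 𝒪[F]]

/-! ## §4 The level of the shell conjugate `r_m⁻¹ γ r_m` -/

omit [IsDiscreteValuationRing 𝒪[F]] in
/-- In the Eisenstein shape a unit `a + bτ` has `|a + bu| = 1` (`|a| = 1`, `|bu| < 1`). [cite: LabesseLanglands1979, §2 p. 8] -/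
theorem valuation_add_mul_eq_one_of_eisenstein {u a b : F} (hu1 : valuation F u < 1) (ha1 : valuation F a = 1) (hb : b ∈ 𝒪[F]) :
    valuation F (a + b * u) = 1 := by
  have hlt : valuation F (b * u) < valuation F a := by
    rw [ha1, map_mul]; exact mul_lt_one_of_nonneg_of_lt_one_right ((Valuation.mem_integer_iff _ _).1 hb) zero_le hu1
  rw [Valuation.map_add_eq_of_lt_left _ hlt, ha1]

include hϖ in
omit [IsDiscreteValuationRing 𝒪[F]] in
/-- **LEVEL `0` BELOW THE FIXED RADIUS**: for `m ≤ oT` the shell conjugate `r_m⁻¹ γ r_m` is integral with a unit entry and unit determinant — primitive data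
`(1, ↑(r_m⁻¹ γ r_m), 0)` (it fixes the root: `γ` fixes `x_m`, ★ I). [cite: LabesseLanglands1979, §2 (2.1) p. 8] -/
theorem level_data_shellConj_of_le {u v a b : F} (hu : u ∈ 𝒪[F]) (hu1 : valuation F u < 1) (hv1 : valuation F v = valuation F ϖ) (ha : a ∈ 𝒪[F]) (hb : b ∈ 𝒪[F])
    {oT : ℕ} (hbn : valuation F b = valuation F ϖ ^ oT)
    {γ rm : GL (Fin 2) F} (hγ : (γ : Matrix (Fin 2) (Fin 2) F) = !![a, b * v; b, a + b * u]) (hγdet : valuation F (γ : Matrix (Fin 2) (Fin 2) F).det = 1)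
    {π : F} (hπ : valuation F π = valuation F ϖ) {m : ℕ} (hrm : (rm : Matrix (Fin 2) (Fin 2) F) = Matrix.diagonal ![1, π ^ m]) (hm : m ≤ oT) :
    ((rm⁻¹ * γ * rm : GL (Fin 2) F) : Matrix (Fin 2) (Fin 2) F) = (1 : F) • ((rm⁻¹ * γ * rm : GL (Fin 2) F) : Matrix (Fin 2) (Fin 2) F) ∧
      (∀ i j, ((rm⁻¹ * γ * rm : GL (Fin 2) F) : Matrix (Fin 2) (Fin 2) F) i j ∈ 𝒪[F]) ∧
      (∃ i j, valuation F (((rm⁻¹ * γ * rm : GL (Fin 2) F) : Matrix (Fin 2) (Fin 2) F) i j) = 1) ∧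
      valuation F ((rm⁻¹ * γ * rm : GL (Fin 2) F) : Matrix (Fin 2) (Fin 2) F).det = valuation F ϖ ^ 0 := by
  have hπ0 : π ≠ 0 := fun h => hϖ.ne_zero ((Valuation.zero_iff _).1 (by rw [← hπ, h, map_zero]))
  have hπint : π ∈ 𝒪[F] := by rw [Valuation.mem_integer_iff, hπ]; exact hϖ.valuation_le_one
  have hv : v ∈ 𝒪[F] := by rw [Valuation.mem_integer_iff, hv1]; exact hϖ.valuation_le_one
  have hN : valuation F (a ^ 2 + a * b * u - b ^ 2 * v) = 1 := by rw [← QuadraticRegularRep.det_regRep u v a b, ← hγ]; exact hγdet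
  have ha1 : valuation F a = 1 := valuation_eq_one_of_eisenstein_norm hϖ hu1 hv1 ha hb hN
  have hcoe := coe_inv_mul_torus_mul_of_coe_eq_diagonal u v a b hγ hrm (pow_ne_zero m hπ0)
  have hint : IsIntegralMatrix (!![a, b * v * π ^ m; b * (π ^ m)⁻¹, a + b * u]) := by
    rw [isIntegralMatrix_shellConj_iff hu hv ha hb (pow_mem hπint m) (pow_ne_zero m hπ0), hbn, map_pow, hπ]
    exact pow_le_pow_right_of_le_one' hϖ.valuation_le_one hm
  refine ⟨by rw [one_smul], fun i j => by rw [hcoe]; exact hint i j, ⟨0, 0, by rw [hcoe]; simpa using ha1⟩, ?_⟩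
  rw [pow_zero, Units.val_mul, Units.val_mul, Matrix.det_mul, Matrix.det_mul, mul_comm (((rm⁻¹ : GL (Fin 2) F)) : Matrix (Fin 2) (Fin 2) F).det, mul_assoc,
    ← Matrix.det_mul, ← Units.val_mul, inv_mul_cancel, Units.val_one, Matrix.det_one, mul_one, hγdet]

include hϖ in
omit [IsDiscreteValuationRing 𝒪[F]] in
/-- **LEVEL `2 (m − oT)` BEYOND THE FIXED RADIUS**: for `m = oT + k` the shell conjugate is `(b ϖ^{−m}) • g₀` with `g₀ = ((rm⁻¹ γ rm) scaled)` primitive integral and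
`|det g₀| = |ϖ|^{2k}`: the vertex `(r_m⁻¹ γ r_m) · v₀` is at distance `2k` from the root. [cite: LabesseLanglands1979, §2 (2.1) p. 8] [cite: Serre1980Trees, Ch. II §1.1] -/
theorem level_data_shellConj_of_ge {u v a b : F} (hu1 : valuation F u < 1) (hv1 : valuation F v = valuation F ϖ) (ha : a ∈ 𝒪[F]) (hb : b ∈ 𝒪[F])
    {oT : ℕ} (hbn : valuation F b = valuation F ϖ ^ oT)
    {γ rm : GL (Fin 2) F} (hγ : (γ : Matrix (Fin 2) (Fin 2) F) = !![a, b * v; b, a + b * u]) (hγdet : valuation F (γ : Matrix (Fin 2) (Fin 2) F).det = 1)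
    {π : F} (hπ : valuation F π = valuation F ϖ) {k : ℕ} (hrm : (rm : Matrix (Fin 2) (Fin 2) F) = Matrix.diagonal ![1, π ^ (oT + k)]) :
    ∃ (c : F) (g₀ : Matrix (Fin 2) (Fin 2) F), c ≠ 0 ∧ ((rm⁻¹ * γ * rm : GL (Fin 2) F) : Matrix (Fin 2) (Fin 2) F) = c • g₀ ∧ (∀ i j, g₀ i j ∈ 𝒪[F]) ∧
      (∃ i j, valuation F (g₀ i j) = 1) ∧ valuation F g₀.det = valuation F ϖ ^ (2 * k) := by
  have h0 := hϖ.ne_zero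
  have hϖpos : 0 < valuation F ϖ := (Valuation.pos_iff _).2 h0
  have hπ0 : π ≠ 0 := fun h => h0 ((Valuation.zero_iff _).1 (by rw [← hπ, h, map_zero]))
  have hπint : π ∈ 𝒪[F] := by rw [Valuation.mem_integer_iff, hπ]; exact hϖ.valuation_le_one
  have hv : v ∈ 𝒪[F] := by rw [Valuation.mem_integer_iff, hv1]; exact hϖ.valuation_le_one
  have hN : valuation F (a ^ 2 + a * b * u - b ^ 2 * v) = 1 := by rw [← QuadraticRegularRep.det_regRep u v a b, ← hγ]; exact hγdet
  have ha1 : valuation F a = 1 := valuation_eq_one_of_eisenstein_norm hϖ hu1 hv1 ha hb hN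
  have hab1 : valuation F (a + b * u) = 1 := valuation_add_mul_eq_one_of_eisenstein hu1 ha1 hb
  have hm0 : π ^ (oT + k) ≠ 0 := pow_ne_zero _ hπ0
  have hcoe := coe_inv_mul_torus_mul_of_coe_eq_diagonal u v a b hγ hrm hm0
  have hb0 : b ≠ 0 := fun hb0 => by rw [hb0, map_zero] at hbn; exact (pow_ne_zero oT hϖpos.ne') hbn.symm
  -- the scalar `c = b π^{−m}` of valuation `|ϖ|^{−k}`
  set c : F := b * (π ^ (oT + k))⁻¹ with hc
  have hc0 : c ≠ 0 := mul_ne_zero hb0 (inv_ne_zero hm0)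
  have hvc : valuation F c * valuation F ϖ ^ k = 1 := by
    rw [hc, map_mul, map_inv₀, map_pow, hπ, hbn, pow_add, mul_inv, mul_assoc, mul_assoc, inv_mul_cancel₀ (pow_ne_zero _ hϖpos.ne'), mul_one,
      mul_inv_cancel₀ (pow_ne_zero _ hϖpos.ne')]
  have hvcinv : valuation F c⁻¹ = valuation F ϖ ^ k := by
    rw [map_inv₀]; exact inv_eq_of_mul_eq_one_right hvc
  refine ⟨c, c⁻¹ • ((rm⁻¹ * γ * rm : GL (Fin 2) F) : Matrix (Fin 2) (Fin 2) F), hc0, by rw [smul_smul, mul_inv_cancel₀ hc0, one_smul], fun i j => ?_,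
    ⟨1, 0, ?_⟩, ?_⟩
  · -- integrality of `c⁻¹ • S_m`, entry by entry
    rw [hcoe, Matrix.smul_apply, smul_eq_mul, Valuation.mem_integer_iff, map_mul, hvcinv]
    have hk1 : valuation F ϖ ^ k ≤ 1 := pow_le_one₀ zero_le hϖ.valuation_le_one
    fin_cases i <;> fin_cases j
    · simpa [ha1] using hk1
    · show valuation F ϖ ^ k * valuation F (b * v * π ^ (oT + k)) ≤ 1
      rw [map_mul, map_mul]
      exact mul_le_one' hk1 (mul_le_one' (mul_le_one' ((Valuation.mem_integer_iff _ _).1 hb) ((Valuation.mem_integer_iff _ _).1 hv))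
        ((Valuation.mem_integer_iff _ _).1 (pow_mem hπint _)))
    · show valuation F ϖ ^ k * valuation F (b * (π ^ (oT + k))⁻¹) ≤ 1
      rw [← hc, mul_comm, hvc]
    · show valuation F ϖ ^ k * valuation F (a + b * u) ≤ 1
      rw [hab1, mul_one]; exact hk1
  · -- the unit entry `(1, 0)`: `c⁻¹ · (b ϖ^{−m}) = 1`
    rw [hcoe, Matrix.smul_apply, smul_eq_mul, map_mul, hvcinv]
    show valuation F ϖ ^ k * valuation F (b * (π ^ (oT + k))⁻¹) = 1
    rw [← hc, mul_comm, hvc]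
  · -- the determinant `c⁻² · N`
    rw [Matrix.det_smul, Fintype.card_fin, map_mul, map_pow, hvcinv, Units.val_mul, Units.val_mul, Matrix.det_mul, Matrix.det_mul,
      mul_comm (((rm⁻¹ : GL (Fin 2) F)) : Matrix (Fin 2) (Fin 2) F).det, mul_assoc, ← Matrix.det_mul, ← Units.val_mul, inv_mul_cancel, Units.val_one,
      Matrix.det_one, mul_one, hγdet, mul_one, ← pow_mul, mul_comm k 2]

/-! ## §5 (V-top) CORE: beyond `oT + R` the shell conjugate has level `> R` -/

include hϖ in
omit [IsDiscreteValuationRing 𝒪[F]] in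
/-- **(V-top) CORE**: if `oT + R < m` then EVERY primitive data `(c, g₀, n)` of the shell conjugate `r_m⁻¹ γ r_m` has `R < n` (indeed `n = 2 (m − oT) > 2R ≥ R` by
`level_unique`).  With the consumer's «support radius `R`» (a bound on the level of the vertices met by `f`) this is `fbar m t = 0`.
[cite: LabesseLanglands1979, §2 (2.1) p. 8] [cite: Serre1980Trees, Ch. II §1.1] -/
theorem level_gt_of_shellConj {u v a b : F} (hu1 : valuation F u < 1) (hv1 : valuation F v = valuation F ϖ) (ha : a ∈ 𝒪[F]) (hb : b ∈ 𝒪[F])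
    {oT : ℕ} (hbn : valuation F b = valuation F ϖ ^ oT)
    {γ rm : GL (Fin 2) F} (hγ : (γ : Matrix (Fin 2) (Fin 2) F) = !![a, b * v; b, a + b * u]) (hγdet : valuation F (γ : Matrix (Fin 2) (Fin 2) F).det = 1)
    {π : F} (hπ : valuation F π = valuation F ϖ) {m R : ℕ} (hrm : (rm : Matrix (Fin 2) (Fin 2) F) = Matrix.diagonal ![1, π ^ m]) (hmR : oT + R < m)
    {c : F} {g₀ : Matrix (Fin 2) (Fin 2) F} {n : ℕ} (hc : c ≠ 0) (hS : ((rm⁻¹ * γ * rm : GL (Fin 2) F) : Matrix (Fin 2) (Fin 2) F) = c • g₀)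
    (hint : ∀ i j, g₀ i j ∈ 𝒪[F]) (hprim : ∃ i j, valuation F (g₀ i j) = 1) (hdet : valuation F g₀.det = valuation F ϖ ^ n) : R < n := by
  obtain ⟨k, rfl⟩ : ∃ k, m = oT + k := ⟨m - oT, by omega⟩
  obtain ⟨c', g₀', hc', hS', hint', hprim', hdet'⟩ := level_data_shellConj_of_ge hϖ hu1 hv1 ha hb hbn hγ hγdet hπ (k := k) hrm
  have hn : n = 2 * k := level_unique hϖ hc hS hint hprim hdet hS' hint' hprim' hdet'
  omega

include hϖ in
omit [IsDiscreteValuationRing 𝒪[F]] in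
/-- The same for any `GL₂(𝒪)`-conjugate `k⁻¹ (r_m⁻¹ γ r_m) k′` of the shell conjugate (the level is `GL₂(𝒪)`-bi-invariant, `primitive_glInt_mul_mul_glInt`) — e.g. the
partner's shell conjugate `D_u⁻¹ (r_m⁻¹ γ r_m) D_u`, `D_u = diag(1, u)` a unit diagonal, or the `K`-conjugates `k⁻¹ S_m k` read by `fbar`. [cite: LabesseLanglands1979, §2 p. 8] -/
theorem level_gt_of_glInt_mul_shellConj_mul_glInt {u v a b : F} (hu1 : valuation F u < 1) (hv1 : valuation F v = valuation F ϖ) (ha : a ∈ 𝒪[F])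
    (hb : b ∈ 𝒪[F]) {oT : ℕ} (hbn : valuation F b = valuation F ϖ ^ oT)
    {γ rm : GL (Fin 2) F} (hγ : (γ : Matrix (Fin 2) (Fin 2) F) = !![a, b * v; b, a + b * u]) (hγdet : valuation F (γ : Matrix (Fin 2) (Fin 2) F).det = 1)
    {π : F} (hπ : valuation F π = valuation F ϖ) {m R : ℕ} (hrm : (rm : Matrix (Fin 2) (Fin 2) F) = Matrix.diagonal ![1, π ^ m]) (hmR : oT + R < m)
    {k k' : GL (Fin 2) F} (hk : k ∈ glInt 2 F) (hk' : k' ∈ glInt 2 F)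
    {c : F} {g₀ : Matrix (Fin 2) (Fin 2) F} {n : ℕ} (hc : c ≠ 0) (hS : ((k * (rm⁻¹ * γ * rm) * k' : GL (Fin 2) F) : Matrix (Fin 2) (Fin 2) F) = c • g₀)
    (hint : ∀ i j, g₀ i j ∈ 𝒪[F]) (hprim : ∃ i j, valuation F (g₀ i j) = 1) (hdet : valuation F g₀.det = valuation F ϖ ^ n) : R < n := by
  obtain ⟨l, rfl⟩ : ∃ l, m = oT + l := ⟨m - oT, by omega⟩
  obtain ⟨c', g₀', hc', hS', hint', hprim', hdet'⟩ := level_data_shellConj_of_ge hϖ hu1 hv1 ha hb hbn hγ hγdet hπ (k := l) hrm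
  obtain ⟨hint2, hprim2, hdet2⟩ := primitive_glInt_mul_mul_glInt hint' hprim' hk hk'
  have hS2 : ((k * (rm⁻¹ * γ * rm) * k' : GL (Fin 2) F) : Matrix (Fin 2) (Fin 2) F) = c' • ((k : Matrix (Fin 2) (Fin 2) F) * g₀' * (k' : Matrix (Fin 2) (Fin 2) F)) := by
    rw [Units.val_mul, Units.val_mul, hS', Matrix.mul_smul, Matrix.smul_mul]
  have hn : n = 2 * l := level_unique hϖ hc hS hint hprim hdet hS2 hint2 hprim2 (hdet2.trans hdet')
  omega

end Literature.NumberTheory.Automorphic.HermitianLatticeTree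

end
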